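import Literature.NumberTheory.EllipticCurves.OrdinaryLocalKummerCountProofs
import Literature.NumberTheory.EllipticCurves.SubgroupCyclotomicLineCocycleCountProofs
import Literature.NumberTheory.EllipticCurves.LocalLayerTwistedKummerCountProofs
import HarnessLib

/-!
# The cocycle count (C1ₙ) at a good ordinary prime on the layer group `H_{v,n}` of a `ℤ_p`-tower

`Proofs` file (theorems only: **no definition, no named fact, nothing asserted**) in topic
`NumberTheory/EllipticCurves`; the layer-`n` twin of `OrdinaryLocalKummerCountProofs` (R. Greenberg,
*Iwasawa theory for elliptic curves*, LNM 1716 (1999), §3 Lemma 3.4, p. 89; §2 Prop. 2.2, p. 73: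
"`H¹(M_η, C)` has `ℤ_p`-corank `[M_η : ℚ_p]`"), feeding hypothesis (C1ₙ) of the rank-free Kummer
skeleton at the layer `n` (`SelmerCorankControlRatOrdinaryLayerUniformizerProofs`,
`finite_localTowerKerPrimary_of_ordinary_of_count_of_uniformizer`). As in the parent file the
reduction map enters only through an abstract additive map `red₀ : E(K̄_v) → B` with the ordinary
filtration (`hgenr`, `hsurj`), an arithmetic Frobenius `τ` fixing `μ_{p^∞}` with finitely many
`τ`-fixed reductions (`SF`), and the Teichmüller layers (`hlayer`); new at the layer `n` are
`τ ∈ H = H_{v,n}` (the layer is totally ramified at `v`) and an `H`-fixed `π` with `|π|^d = |p|`,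
`pⁿ ∣ d` (a uniformiser of `(K_n)_v` when `d = pⁿ`).

* `WeierstrassCurve.exists_finset_cocycle_reps_of_ordinaryLine_layer` — **(C1ₙ)**: for every `k`
  the continuous cocycles `H_{v,n} → ker red₀ ∩ E[p^k]` fall into at most `#SF² · q^d · q^{dk}`
  classes modulo coboundaries of `p^k`-torsion points (`q = #k_v`): the cyclotomic line `ℤ P₀`
  (`localPoints_exists_isPrimitiveRoot_smul_eq_pow`), the count on the open subgroup `H`
  (`exists_finset_cocycle_reps_of_cyclotomicLine_subgroup`, step (4)) fed with the twisted Kummer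
  count over the layer field `K̄_v^{N' ∩ H}` (`exists_finset_forall_frobenius_pow_rep_layerField`,
  step (2)), and the bounds `N_e, M₀ ≤ #SF` of `card_filter_smul_nsmul_eq_le` (`τ ∈ H`). The exponent
  `d·k ≥ [(K_n)_v : ℚ_p]·k` is Greenberg's corank of `H¹((K_n)_v, C)`.

HONEST FRAMING (cell `bsd-f1-sign2`, WIDTH-5 attach seat `bsd-line-att-p5` g42 on crux
stmt-BirchSwinnertonDyer-22298, lineage successor of g41): step (5a) of the route to (C1ₙ) (memo
`Cruxes/MainConjectureOfRankZeroBSDAtTwo/LEMMA34-LAYERS-att-p5-g41.md` §6); closes no item; BSD is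
not proved by any of this.

## References

* [GreenbergLNM1716] R. Greenberg, LNM 1716 (1999), §2 Prop. 2.2 (p. 73), §3 Lemma 3.4 (p. 89).
* [SilvermanAEC2009] J. H. Silverman, *The Arithmetic of Elliptic Curves*, III.8.1, VII.2.1.
-/

noncomputable section

open scoped Classical NNReal AddSubgroup
open NumberField IsDedekindDomain

universe u

namespace WeierstrassCurve

open Literature.NumberTheory.EllipticCurves Literature.NumberTheory.GaloisRepresentations Field

section Count

variable {K : Type u} [Field K] [NumberField K] {v : HeightOneSpectrum (𝓞 K)}
  {w : Valuation (AlgebraicClosure (v.adicCompletion K)) ℝ≥0}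
  (hw : ∀ x, (w x : ℝ) = spectralNorm (v.adicCompletion K) (AlgebraicClosure (v.adicCompletion K)) x)
  {𝔐 : Ideal v.localAbsIntegers} (h𝔐 : 𝔐 ∈ v.localPrimesAbove)
  {p : ℕ} [hp : Fact p.Prime] (hpv : (p : 𝓞 K) ∈ v.asIdeal)
  (hϖ : Irreducible ((p : ℕ) : v.adicCompletionIntegers K))
  (W : WeierstrassCurve K) [W.IsElliptic]
  {B : Type*} [AddCommGroup B] (red₀ : localPoints W (v.adicCompletion K) →+ B)
  (hstab : ∀ (σ : absoluteGaloisGroup (v.adicCompletion K)) (Q : localPoints W (v.adicCompletion K)),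
    red₀ Q = 0 → red₀ (σ • Q) = 0)
  {τ : absoluteGaloisGroup (v.adicCompletion K)}
  (hτ : IsArithFrobAt (v.adicCompletionIntegers K) τ 𝔐)
  (hτfix : ∀ (k : ℕ) (ξ : AlgebraicClosure (v.adicCompletion K)), ξ ^ p ^ k = 1 → τ • ξ = ξ)
  (hgenr : ∀ r : ℕ, ∃ P₁ : localPoints W (v.adicCompletion K), red₀ P₁ = 0 ∧
    addOrderOf P₁ = p ^ r ∧ ∀ P : localPoints W (v.adicCompletion K), red₀ P = 0 →
      ((p ^ r : ℕ) : ℤ) • P = 0 → ∃ c : ℕ, P = c • P₁)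
  (hsurj : ∀ (r : ℕ) (y : B), ((p ^ r : ℕ) : ℤ) • y = 0 →
    ∃ x : localPoints W (v.adicCompletion K), ((p ^ r : ℕ) : ℤ) • x = 0 ∧ red₀ x = y)
  (SF : Finset B)
  (hSF : ∀ Q : localPoints W (v.adicCompletion K), red₀ (τ • Q) = red₀ Q → red₀ Q ∈ SF)
  (hlayer : ∀ F : Finset (localPoints W (v.adicCompletion K)), ∃ f : ℕ, f ≠ 0 ∧
    ∀ ζL : AlgebraicClosure (v.adicCompletion K),
      IsPrimitiveRoot ζL (Nat.card (IsLocalRing.ResidueField (v.adicCompletionIntegers K)) ^ f - 1) →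
        ∀ σ : absoluteGaloisGroup (v.adicCompletion K), σ • ζL = ζL →
          ∀ Q ∈ F, red₀ (σ • Q) = red₀ Q)
  (κ : ZpExtension K p) (n : ℕ)
  (hτH : τ ∈ localSubgroup (κ.layerSubgroup n) (v.adicCompletion K))
  {d : ℕ} (hdn : p ^ n ∣ d)
  {π : AlgebraicClosure (v.adicCompletion K)}
  (hπH : ∀ σ ∈ localSubgroup (κ.layerSubgroup n) (v.adicCompletion K), σ • π = π)
  (hπ : w π ^ d = w (p : AlgebraicClosure (v.adicCompletion K)))

include hw h𝔐 hpv hϖ hstab hτ hτfix hgenr hsurj hSF hlayer hτH hdn hπH hπ in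
set_option maxHeartbeats 1600000 in
/-- **(C1ₙ) at a good ordinary prime: the cocycles `H_{v,n} → ker red₀ ∩ E[p^k]` fall into at most
`#SF² · q^d · q^{dk}` classes modulo coboundaries of `p^k`-torsion points** (`q = #k_v`,
`H_{v,n} = (Γ_{K_v} → Γ_K)⁻¹(Gal(K̄/K_n))` containing the Frobenius `τ`, `π` fixed by `H_{v,n}` with
`|π|^d = |p|`, `pⁿ ∣ d`). With `P₀` a generator of `ker red₀ ∩ E[p^k]` (order `p^k`), every such
cocycle is `ℤP₀`-valued; every `σ ∈ Γ_{K_v}` acts on `P₀` by a scalar `c(σ)`; over a Teichmüller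
layer `K_v(ζ_{q^f-1})` fixing the reductions of chosen lifts of `B[p^k]` (`hlayer`) the Weil pairing
gives a primitive `p^k`-th root of unity `ζ` with `σζ = ζ^{c(σ)}`
(`localPoints_exists_isPrimitiveRoot_smul_eq_pow`); `τζ = ζ`, `τP₀ = bP₀`, `e = c(τ⁻¹) ≡ b⁻¹`. The
twisted Kummer count over the layer field `L = K̄_v^{N' ∩ H_{v,n}}`
(`exists_finset_forall_frobenius_pow_rep_layerField`: `≤ N_e · q^{d+dk}` classes) feeds the cocycle
count on the open subgroup `H_{v,n}` (`exists_finset_cocycle_reps_of_cyclotomicLine_subgroup`: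
`≤ N_e · q^{d+dk} · M₀` classes), and both `N_e = #{i : τ(iP₀) = iP₀}` and
`M₀ ≤ #{i : τ(iP₀) = iP₀}` are `≤ #SF` (`card_filter_smul_nsmul_eq_le`). This is Greenberg's
"`H¹(M_η, C)` has `ℤ_p`-corank `[M_η : ℚ_p]`" (LNM 1716, §2 Prop. 2.2, p. 73) for the completed
layer `M_η = (K_n)_v`, in the counted form needed by §3 Lemma 3.4 (p. 89) at the layer `n`.
[cite: GreenbergLNM1716, §3 Lemma 3.4 (p. 89)] [cite: GreenbergLNM1716, §2 Prop. 2.2 (p. 73)] -/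
theorem exists_finset_cocycle_reps_of_ordinaryLine_layer (k : ℕ) :
    ∃ S : Finset (contOneCocycles (discreteTopRep
      (localSubgroup (κ.layerSubgroup n) (v.adicCompletion K)) (localPoints W (v.adicCompletion K)))),
      S.card ≤ SF.card * SF.card *
        Nat.card (IsLocalRing.ResidueField (v.adicCompletionIntegers K)) ^ d *
        Nat.card (IsLocalRing.ResidueField (v.adicCompletionIntegers K)) ^ (d * k) ∧
      ∀ ψ : contOneCocycles (discreteTopRep
        (localSubgroup (κ.layerSubgroup n) (v.adicCompletion K)) (localPoints W (v.adicCompletion K))),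
        (∀ g, p ^ k • ψ.1 g = 0) → (∀ g, red₀ (ψ.1 g) = 0) →
          ∃ ψ₀ ∈ S, ∃ t : localPoints W (v.adicCompletion K), p ^ k • t = 0 ∧
            ∀ g : localSubgroup (κ.layerSubgroup n) (v.adicCompletion K),
              ψ.1 g - ψ₀.1 g = g • t - t := by
  haveI : CharZero (v.adicCompletion K) :=
    charZero_of_injective_algebraMap (algebraMap K (v.adicCompletion K)).injective
  haveI : CharZero (AlgebraicClosure (v.adicCompletion K)) := charZero_of_injective_algebraMap
    (algebraMap (v.adicCompletion K) (AlgebraicClosure (v.adicCompletion K))).injective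
  set H : Subgroup (absoluteGaloisGroup (v.adicCompletion K)) :=
    localSubgroup (κ.layerSubgroup n) (v.adicCompletion K) with hHdef
  have hHopen : IsOpen (H : Set (absoluteGaloisGroup (v.adicCompletion K))) :=
    isOpen_localSubgroup_layerSubgroup (v.adicCompletion K) κ n
  have hpk : p ^ k ≠ 0 := pow_ne_zero k hp.out.ne_zero
  -- the generator `P₀` of `ker red₀ ∩ E[p^k]`
  obtain ⟨P₀, hP₀, hordP₀, hgen₀⟩ := hgenr k
  have hP₀Z : ∀ m : ℤ, m • P₀ = 0 ↔ ((p ^ k : ℕ) : ℤ) ∣ m := fun m ↦ by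
    rw [← addOrderOf_dvd_iff_zsmul_eq_zero, hordP₀]
  have hpkP₀ : (p ^ k) • P₀ = 0 := by rw [← hordP₀]; exact addOrderOf_nsmul_eq_zero P₀
  -- every `σ` acts on `P₀` by a scalar `c σ`
  have hscal : ∀ σ : absoluteGaloisGroup (v.adicCompletion K), ∃ c : ℕ, σ • P₀ = c • P₀ :=
    fun σ ↦ hgen₀ (σ • P₀) (hstab σ P₀ hP₀)
      (by rw [natCast_zsmul, smul_comm, hpkP₀, smul_zero])
  choose c hc using hscal
  -- `e = c τ⁻¹` is inverse to `b = c τ` modulo `p^k`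
  have he : ((p ^ k : ℕ) : ℤ) ∣ ((c τ⁻¹ * c τ : ℕ) : ℤ) - ((1 : ℕ) : ℤ) := by
    rw [← IsDedekindDomain.HeightOneSpectrum.nsmul_eq_nsmul_iff_dvd_sub hP₀Z]
    rw [one_smul, mul_comm, mul_smul, ← hc τ⁻¹, smul_comm (c τ) τ⁻¹ P₀, ← hc τ, inv_smul_smul]
  -- lifts of `B[p^k]` and the Teichmüller layer
  have hsurjk : ∀ y ∈ B[(p ^ k : ℕ)], ∃ x ∈ (localPoints W (v.adicCompletion K))[(p ^ k : ℕ)],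
      red₀ x = y := by
    intro y hy
    obtain ⟨x, hx, hxy⟩ := hsurj k y (mem_torsionBy_iff.mp hy)
    exact ⟨x, mem_torsionBy_iff.mpr hx, hxy⟩
  haveI : Finite (B[(p ^ k : ℕ)]) := by
    have hmul := TateModule.card_ker_torsionBy_mul_card red₀ (p ^ k) hsurjk
    have hA : Nat.card ((localPoints W (v.adicCompletion K))[(p ^ k : ℕ)]) = (p ^ k) ^ 2 :=
      card_torsionBy_eq_sq (E := W.baseChange (AlgebraicClosure (v.adicCompletion K)))
        (n := p ^ k) (by exact_mod_cast hpk)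
    refine Nat.finite_of_card_ne_zero fun h0 ↦ ?_
    rw [h0, mul_zero, hA] at hmul
    exact pow_ne_zero 2 hpk hmul.symm
  haveI : Fintype (B[(p ^ k : ℕ)]) := Fintype.ofFinite _
  choose lift hlift₁ hlift₂ using hsurj k
  set F : Finset (localPoints W (v.adicCompletion K)) :=
    Finset.univ.image fun y : B[(p ^ k : ℕ)] ↦ lift (y : B) (mem_torsionBy_iff.mp y.2) with hFdef
  obtain ⟨f, hf, hF⟩ := hlayer F
  -- a primitive `(q^f - 1)`-th root of unity
  have hm0 : Nat.card (IsLocalRing.ResidueField (v.adicCompletionIntegers K)) ^ f - 1 ≠ 0 :=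
    IsDedekindDomain.HeightOneSpectrum.residueCard_pow_sub_one_ne_zero (v := v) hf
  haveI : NeZero ((Nat.card (IsLocalRing.ResidueField (v.adicCompletionIntegers K)) ^ f - 1 : ℕ) :
      AlgebraicClosure (v.adicCompletion K)) := ⟨by exact_mod_cast hm0⟩
  obtain ⟨ζL, hζL⟩ := HasEnoughRootsOfUnity.exists_primitiveRoot
    (AlgebraicClosure (v.adicCompletion K))
    (Nat.card (IsLocalRing.ResidueField (v.adicCompletionIntegers K)) ^ f - 1)
  have hζLpow : ζL ^ (Nat.card (IsLocalRing.ResidueField (v.adicCompletionIntegers K)) ^ f - 1) = 1 :=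
    hζL.pow_eq_one
  -- over the layer, every `σ` acts trivially on `E[p^k]/ℤP₀`
  have h2 : ∀ σ ∈ {σ : absoluteGaloisGroup (v.adicCompletion K) | σ • ζL = ζL},
      ∀ Q : localPoints W (v.adicCompletion K), ((p ^ k : ℕ) : ℤ) • Q = 0 →
        ∃ d' : ℕ, σ • Q - (fun _ : absoluteGaloisGroup (v.adicCompletion K) ↦ (1 : ℕ)) σ • Q =
          d' • P₀ := by
    intro σ hσ Q hQ
    have hy : ((p ^ k : ℕ) : ℤ) • red₀ Q = 0 := by rw [← map_zsmul, hQ, map_zero]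
    have hx : ((p ^ k : ℕ) : ℤ) • lift (red₀ Q) hy = 0 := hlift₁ _ hy
    have hxy : red₀ (lift (red₀ Q) hy) = red₀ Q := hlift₂ _ hy
    have hxF : lift (red₀ Q) hy ∈ F :=
      Finset.mem_image.mpr ⟨⟨red₀ Q, mem_torsionBy_iff.mpr hy⟩, Finset.mem_univ _, rfl⟩
    -- `Q - x ∈ ℤP₀` and `σx - x ∈ ℤP₀`
    obtain ⟨d₁, hd₁⟩ := hgen₀ (Q - lift (red₀ Q) hy) (by rw [map_sub, hxy, sub_self])
      (by rw [smul_sub, hQ, hx, sub_self])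
    obtain ⟨d₂, hd₂⟩ := hgen₀ (σ • lift (red₀ Q) hy - lift (red₀ Q) hy)
      (by rw [map_sub, hF ζL hζL σ hσ _ hxF, sub_self])
      (by rw [smul_sub, natCast_zsmul, natCast_zsmul, smul_comm, ← natCast_zsmul, hx, smul_zero,
        sub_self])
    obtain ⟨d₃, hd₃⟩ :=
      IsDedekindDomain.HeightOneSpectrum.exists_nsmul_eq_sub hP₀Z hpk (d₁ * c σ) d₁
    refine ⟨d₃ + d₂, ?_⟩
    have e1 : σ • Q - (1 : ℕ) • Q =
        σ • (Q - lift (red₀ Q) hy) - (Q - lift (red₀ Q) hy) +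
          (σ • lift (red₀ Q) hy - lift (red₀ Q) hy) := by
      rw [one_smul, smul_sub]; abel
    rw [e1, hd₂, hd₁, smul_comm σ d₁ P₀, hc σ, ← mul_smul, add_smul, ← hd₃]
  have h1 : ∀ σ ∈ {σ : absoluteGaloisGroup (v.adicCompletion K) | σ • ζL = ζL},
      σ • P₀ = c σ • P₀ := fun σ _ ↦ hc σ
  obtain ⟨ζ, hζ, hζσ⟩ := W.localPoints_exists_isPrimitiveRoot_smul_eq_pow (v.adicCompletion K)
    hordP₀ {σ | σ • ζL = ζL} c (fun _ ↦ 1) h1 h2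
  have hN' : ∀ σ : absoluteGaloisGroup (v.adicCompletion K), σ • ζL = ζL →
      ∃ c' : ℕ, σ • P₀ = c' • P₀ ∧ σ • ζ = ζ ^ c' :=
    fun σ hσ ↦ ⟨c σ, hc σ, by rw [hζσ σ hσ, one_mul]⟩
  have ha : τ • ζ = ζ ^ (1 : ℕ) := by rw [pow_one]; exact hτfix k ζ hζ.pow_eq_one
  have hb : τ • P₀ = c τ • P₀ := hc τ
  -- the layer field `L = K̄_v^{N' ∩ H}` and the twisted Kummer count over it
  obtain ⟨L, hLmem⟩ := IsDedekindDomain.HeightOneSpectrum.exists_layerField_mem_iff (v := v) H ζL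
  have hL1 : ∀ σ ∈ H, σ • ζL = ζL → ∀ y ∈ L, σ • y = y :=
    fun σ hσH hσ y hy ↦ (hLmem y).mp hy σ hσH hσ
  have hL2 : ∀ τ' : AlgebraicClosure (v.adicCompletion K) ≃ₐ[L] AlgebraicClosure (v.adicCompletion K),
      toAbsGalHom L τ' ∈ H ∧ toAbsGalHom L τ' • ζL = ζL := fun τ' ↦
    IsDedekindDomain.HeightOneSpectrum.toAbsGalHom_mem_of_layerField hHopen hm0 hζLpow hLmem τ'
  have hL3 : ∀ y : AlgebraicClosure (v.adicCompletion K), (∀ σ ∈ H, σ • ζL = ζL → σ • y = y) →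
      y ∈ L := fun y hy ↦ (hLmem y).mpr hy
  have hR := IsDedekindDomain.HeightOneSpectrum.exists_finset_forall_frobenius_pow_rep_layerField hw h𝔐
    hpv hϖ κ n hτ hτH hdn hπH hπ hf hζL hLmem k (c τ⁻¹)
  -- the count over the cyclotomic line on the open subgroup `H`
  obtain ⟨S, hScard, hSrep⟩ :=
    IsDedekindDomain.HeightOneSpectrum.exists_finset_cocycle_reps_of_cyclotomicLine_subgroup hw h𝔐 hτ
      H hHopen hτH hf hζL L hL1 hL2 hL3 (continuous_smul_localPoints W (v.adicCompletion K)) hP₀Z hζ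
      hN' ha hb he hR
  -- both constants are bounded by `#SF`
  have hF1 := W.card_filter_smul_nsmul_eq_le (v.adicCompletion K) red₀ hτfix hgenr hsurj SF hSF
    hP₀ hordP₀
  have hN : ((Finset.range (p ^ k)).filter fun i : ℕ ↦
      ((p ^ k : ℕ) : ℤ) ∣ (((c τ⁻¹ : ℕ) : ℤ) - 1) * i).card ≤ SF.card := by
    refine le_trans (Finset.card_le_card fun i hi ↦ ?_) hF1
    rw [Finset.mem_filter] at hi ⊢
    refine ⟨hi.1, ?_⟩
    rw [smul_comm τ i P₀, hc τ, ← mul_smul,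
      IsDedekindDomain.HeightOneSpectrum.nsmul_eq_nsmul_iff_dvd_sub hP₀Z]
    obtain ⟨c₁, hc₁⟩ := he
    obtain ⟨c₂, hc₂⟩ := hi.2
    push_cast at hc₁ hc₂ ⊢
    exact ⟨(i : ℤ) * c₁ - (c τ : ℤ) * c₂, by linear_combination (i : ℤ) * hc₁ - (c τ : ℤ) * hc₂⟩
  have hM₀ : ((Finset.range (p ^ k)).filter fun i : ℕ ↦
      ∀ σ ∈ H, σ • (i • P₀) = i • P₀).card ≤ SF.card := by
    refine le_trans (Finset.card_le_card fun i hi ↦ ?_) hF1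
    rw [Finset.mem_filter] at hi ⊢
    exact ⟨hi.1, hi.2 τ hτH⟩
  refine ⟨S, ?_, fun ψ hψp hψr ↦ hSrep ψ fun g ↦ hgen₀ (ψ.1 g) (hψr g)
    (by rw [natCast_zsmul]; exact hψp g)⟩
  obtain ⟨R, hRcard, -, -⟩ := hR
  calc S.card ≤ _ := hScard
    _ ≤ SF.card * Nat.card (IsLocalRing.ResidueField (v.adicCompletionIntegers K)) ^ (d + k * d) *
        SF.card := by
      refine Nat.mul_le_mul (le_trans ?_ (Nat.mul_le_mul_right _ hN)) hM₀
      exact le_rfl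
    _ = SF.card * SF.card * Nat.card (IsLocalRing.ResidueField (v.adicCompletionIntegers K)) ^ d *
        Nat.card (IsLocalRing.ResidueField (v.adicCompletionIntegers K)) ^ (d * k) := by
      rw [pow_add, mul_comm k d]; ring

end Count

end WeierstrassCurve
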